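import Summits.Parity.GeneralizedHardyLittlewood.Theorems.GreenTaoLevelTwoGITwoCyclicInverseDerivatives
import Mathlib.Algebra.Order.Chebyshev
import HarnessLib

/-!
# Route `GreenTaoLevelTwo`, crux `GITwo` (stmt-Parity-21275), line `birth`, stub `stub_cyclicInverse`:
# Gowers' argument, step 2 — the frequency graph `{(t, ξ_t)}` has many additive quadruples

Second file of §5 of B. Green, T. Tao, *An inverse theorem for the Gowers `U³(G)` norm* (PEMS 51
(2008); the XL stub `stub_cyclicInverse` = Thm. 12.8 of that paper).  The first file
(`GreenTaoLevelTwoGITwoCyclicInverseDerivatives.lean`) extracted from `‖f‖_{U³(ℤ/Mℤ)}^8 ≥ ε`,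
`|f| ≤ 1`, a set `H` of `≥ εM/2` shifts and frequencies `ξ_t` with `|(Δ_t f)^(ξ_t)|² ≥ ε/2`
(`Δ_t f (y) = f(y) f(y+t)`).  Here we land the second half of GT08a Prop. 5.4 (Gowers 1998,
Lemma 3 / Prop. 6.1): the graph `Γ = {(t, ξ_t) : t ∈ H} ⊆ (ℤ/Mℤ)²` contains `≥ ε^8 M³ / 256` additive
quadruples.  Everything is def-free and over the tree's `dftCoeff` / `gowersPower`.

The argument (two Cauchy–Schwarz steps and Parseval), as formalised:
* `ofReal_norm_dftCoeff_sq` — `|ĝ(ξ)|² = M⁻² ∑_{x,k} g(x) g(x+k) e(kξ/M)`;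
* `ofReal_sum_norm_dftCoeff_sq_deriv` — summing over `t ∈ H` with `g = Δ_t f` and factoring
  `f(x) f(x+k)`: `∑_{t∈H} |(Δ_t f)^(ξ_t)|² = M⁻² ∑_{x,k} f(x)f(x+k) S(x,k)`,
  `S(x,k) = ∑_{t ∈ H} f(x+t) f(x+k+t) e(kξ_t/M)`;
* `mul_card_le_sum_norm` and `sq_sum_sum_norm_le` — `γ #H ≤ M⁻² ∑ |S|`, `(∑|S|)² ≤ M² ∑ |S|²`;
* `ofReal_sum_norm_sq_eq` — `∑_x |S(x,k)|² = ∑_{t,t' ∈ H} e(k(ξ_t − ξ_{t'})/M) B(k, t − t')` with the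
  real second-derivative sums `B(k,d) = ∑_u f(u)f(u+k)f(u+d)f(u+k+d)`;
* `ofReal_sum_sum_norm_sq_eq_sum_fiber` — regrouping along the fibres of
  `(t,t') ↦ (t − t', ξ_t − ξ_{t'})`: `∑_{x,k}|S|² = ∑_v R(v) Φ(v)`, `R(v) = #`fibre,
  `Φ(d,θ) = ∑_k e(kθ/M) B(k,d) = M · (B(·,d))^(−θ)`;
* `sum_norm_sq_phase_sum_le` — Parseval: `∑_θ |Φ(d,θ)|² ≤ M⁴`;
* `gowers_fiber_energy_ge` — **the core**: `γ⁴ #H⁴ ≤ M ∑_v R(v)²`;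
* `sum_sq_card_fiber_eq_card_filter` — `∑_v R(v)² =` the number of pairs of pairs in the same
  fibre, i.e. of quadruples `t₁ − t₂ = t₃ − t₄`, `ξ_{t₁} − ξ_{t₂} = ξ_{t₃} − ξ_{t₄}` in `H⁴`;
* `exists_shifts_freq_quadruples_of_gowersPower_three` — **GT08a Prop. 5.4**: `|f| ≤ 1`,
  `‖f‖_{U³}^8 ≥ ε > 0` ⇒ `H`, `ξ` as above with `≥ ε⁸ M³/256` such quadruples (difference form;
  the printed sum form `t₁ + t₂ = t₃ + t₄` is the same count after relabelling `(t₂ ↔ t₃)`-wise).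

Next (not here): §6 (Balog–Szemerédi–Gowers and Plünnecke–Ruzsa ⇒ `ξ` agrees with an affine /
Freiman-linear map on a large structured set), §§7–10, §12.

References: [GreenTao2008U3Inverse] B. Green, T. Tao, PEMS 51 (2008) 73–153, Prop. 5.4
(arXiv:math/0503014 §5); W. T. Gowers, GAFA 8 (1998) 529–551, §3.
-/

noncomputable section

open Finset ZMod
open scoped BigOperators ComplexConjugate

namespace Summit.Parity.GeneralizedHardyLittlewood.GreenTaoLevelTwoGITwoCyclicInverse

open Literature.NumberTheory.Sieve

variable {M : ℕ} [NeZero M]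

/-! ### Step (a): `|ĝ(ξ)|²` as a double sum over a base point and a shift -/

/-- A real number coerced to `ℂ`: `((‖z‖² : ℝ) : ℂ) = z · conj z`. [folklore] -/
theorem ofReal_norm_sq_eq_mul_conj (z : ℂ) : (((‖z‖ ^ 2 : ℝ)) : ℂ) = z * conj z := by
  rw [Complex.mul_conj, Complex.normSq_eq_norm_sq]

/-- `|ĝ(ξ)|² = M⁻² ∑_x ∑_k g(x) g(x+k) e(kξ/M)` for real `g` on `ℤ/Mℤ`. [folklore] -/
theorem ofReal_norm_dftCoeff_sq (g : ZMod M → ℝ) (ξ : ZMod M) :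
    (((‖dftCoeff g ξ‖ ^ 2 : ℝ)) : ℂ) =
      (∑ x : ZMod M, ∑ k : ZMod M, (g x : ℂ) * g (x + k) * stdAddChar (k * ξ)) / ((M : ℂ) * M) := by
  rw [ofReal_norm_sq_eq_mul_conj, dftCoeff_mul_conj]
  congr 1
  refine Finset.sum_congr rfl fun x _ => ?_
  rw [← Equiv.sum_comp (Equiv.addLeft x)]
  refine Finset.sum_congr rfl fun k _ => ?_
  simp only [Equiv.coe_addLeft, add_sub_cancel_left]

/-! ### Step (b): summing over the shifts `t ∈ H` and factoring `f(x) f(x+k)` -/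

/-- `∑_{t ∈ H} |(Δ_t f)^(ξ_t)|² = M⁻² ∑_{x,k} f(x) f(x+k) · S(x,k)` with
`S(x,k) = ∑_{t ∈ H} f(x+t) f(x+k+t) e(kξ_t/M)`.
[cite: GreenTao2008U3Inverse, §5, proof of Prop. 5.4] -/
theorem ofReal_sum_norm_dftCoeff_sq_deriv (f : ZMod M → ℝ) (H : Finset (ZMod M))
    (ξ : ZMod M → ZMod M) :
    (((∑ t ∈ H, ‖dftCoeff (fun y => f y * f (y + t)) (ξ t)‖ ^ 2 : ℝ)) : ℂ) =
      (∑ x : ZMod M, ∑ k : ZMod M, (((f x * f (x + k) : ℝ)) : ℂ) *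
          ∑ t ∈ H, (f (x + t) : ℂ) * f (x + k + t) * stdAddChar (k * ξ t)) / ((M : ℂ) * M) := by
  rw [Complex.ofReal_sum,
    Finset.sum_congr rfl fun t _ => ofReal_norm_dftCoeff_sq (fun y => f y * f (y + t)) (ξ t),
    ← Finset.sum_div]
  congr 1
  rw [Finset.sum_comm]
  refine Finset.sum_congr rfl fun x _ => ?_
  rw [Finset.sum_comm]
  refine Finset.sum_congr rfl fun k _ => ?_
  rw [Finset.mul_sum]
  refine Finset.sum_congr rfl fun t _ => ?_
  push_cast
  ring

/-! ### Step (c): the first Cauchy–Schwarz -/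

/-- `γ · #H ≤ M⁻² ∑_{x,k} |S(x,k)|` when `|(Δ_t f)^(ξ_t)|² ≥ γ` on `H` and `|f| ≤ 1`.
[cite: GreenTao2008U3Inverse, §5, proof of Prop. 5.4] -/
theorem mul_card_le_sum_norm {f : ZMod M → ℝ} (hf : ∀ x, |f x| ≤ 1) (H : Finset (ZMod M))
    (ξ : ZMod M → ZMod M) {γ : ℝ}
    (hH : ∀ t ∈ H, γ ≤ ‖dftCoeff (fun y => f y * f (y + t)) (ξ t)‖ ^ 2) :
    γ * #H ≤ (∑ x : ZMod M, ∑ k : ZMod M,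
        ‖∑ t ∈ H, (f (x + t) : ℂ) * f (x + k + t) * stdAddChar (k * ξ t)‖) / ((M : ℝ) * M) := by
  have hMpos : (0 : ℝ) < M := by exact_mod_cast Nat.pos_of_ne_zero (NeZero.ne M)
  set r : ℝ := ∑ t ∈ H, ‖dftCoeff (fun y => f y * f (y + t)) (ξ t)‖ ^ 2 with hr
  have h1 : γ * #H ≤ r := by
    calc γ * #H = ∑ _t ∈ H, γ := by rw [sum_const, nsmul_eq_mul, mul_comm]
      _ ≤ r := sum_le_sum fun t ht => hH t ht
  have hr0 : 0 ≤ r := sum_nonneg fun t _ => by positivity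
  have h2 : r = ‖((r : ℝ) : ℂ)‖ := by rw [Complex.norm_real, Real.norm_of_nonneg hr0]
  refine h1.trans ?_
  rw [h2, hr, ofReal_sum_norm_dftCoeff_sq_deriv f H ξ, norm_div, norm_mul, Complex.norm_natCast]
  refine div_le_div_of_nonneg_right ?_ (by positivity)
  refine (norm_sum_le _ _).trans (sum_le_sum fun x _ => ?_)
  refine (norm_sum_le _ _).trans (sum_le_sum fun k _ => ?_)
  rw [norm_mul]
  refine mul_le_of_le_one_left (norm_nonneg _) ?_
  rw [Complex.norm_real, Real.norm_eq_abs]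
  exact abs_mul_shift_le_one hf k x

/-- `(∑_{x,k} |S(x,k)|)² ≤ M² ∑_{x,k} |S(x,k)|²` (Cauchy–Schwarz over `(ℤ/Mℤ)²`). [folklore] -/
theorem sq_sum_sum_norm_le (S : ZMod M → ZMod M → ℂ) :
    (∑ x : ZMod M, ∑ k : ZMod M, ‖S x k‖) ^ 2 ≤
      ((M : ℝ) * M) * ∑ x : ZMod M, ∑ k : ZMod M, ‖S x k‖ ^ 2 := by
  rw [← Fintype.sum_prod_type', ← Fintype.sum_prod_type']
  have h := sq_sum_le_card_mul_sum_sq (s := (univ : Finset (ZMod M × ZMod M)))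
    (f := fun p : ZMod M × ZMod M => ‖S p.1 p.2‖)
  rw [card_univ, Fintype.card_prod, ZMod.card] at h
  push_cast at h
  exact h

/-! ### Step (d): expanding `|S(x,k)|²` and substituting `u = x + t'` -/

/-- Re-indexing a sum over `ℤ/Mℤ` by the translation `x = u − a`. [folklore] -/
theorem sum_comp_sub_right (F : ZMod M → ℂ) (a : ZMod M) :
    ∑ u : ZMod M, F (u - a) = ∑ x : ZMod M, F x :=
  Equiv.sum_comp (Equiv.subRight a) F

/-- `∑_x |S(x,k)|² = ∑_{t,t' ∈ H} e(k(ξ_t − ξ_{t'})/M) · B(k, t − t')` with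
`B(k,d) = ∑_u f(u) f(u+k) f(u+d) f(u+k+d)`. [cite: GreenTao2008U3Inverse, §5, proof of Prop. 5.4] -/
theorem ofReal_sum_norm_sq_eq (f : ZMod M → ℝ) (H : Finset (ZMod M)) (ξ : ZMod M → ZMod M)
    (k : ZMod M) :
    (((∑ x : ZMod M, ‖∑ t ∈ H, (f (x + t) : ℂ) * f (x + k + t) * stdAddChar (k * ξ t)‖ ^ 2 : ℝ)) : ℂ) =
      ∑ t ∈ H, ∑ t' ∈ H, (stdAddChar (k * (ξ t - ξ t')) : ℂ) *
        (((∑ u : ZMod M, f u * f (u + k) * f (u + (t - t')) * f (u + k + (t - t')) : ℝ)) : ℂ) := by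
  rw [Complex.ofReal_sum]
  simp_rw [ofReal_norm_sq_eq_mul_conj, map_sum, map_mul, Complex.conj_ofReal, conj_stdAddChar,
    Finset.sum_mul_sum]
  rw [Finset.sum_comm]
  refine Finset.sum_congr rfl fun t _ => ?_
  rw [Finset.sum_comm]
  refine Finset.sum_congr rfl fun t' _ => ?_
  push_cast
  rw [Finset.mul_sum, ← sum_comp_sub_right _ t']
  refine Finset.sum_congr rfl fun u _ => ?_
  have e1 : u - t' + t = u + (t - t') := by abel
  have e2 : u - t' + k + t = u + k + (t - t') := by abel
  have e3 : u - t' + t' = u := by abel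
  have e4 : u - t' + k + t' = u + k := by abel
  rw [e1, e2, e3, e4]
  have e5 : (stdAddChar (k * ξ t) : ℂ) * stdAddChar (-(k * ξ t')) = stdAddChar (k * (ξ t - ξ t')) := by
    rw [← AddChar.map_add_eq_mul]
    congr 1
    ring
  rw [← e5]
  ring

/-! ### Step (e): regrouping along the fibres of `(t, t') ↦ (t − t', ξ_t − ξ_{t'})` -/

/-- `∑_{x,k} |S(x,k)|² = ∑_{(t,t') ∈ H²} Φ(t − t', ξ_t − ξ_{t'})` with
`Φ(d,θ) = ∑_k e(kθ/M) B(k,d)`. [cite: GreenTao2008U3Inverse, §5, proof of Prop. 5.4] -/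
theorem ofReal_sum_sum_norm_sq_eq_sum_pairs (f : ZMod M → ℝ) (H : Finset (ZMod M))
    (ξ : ZMod M → ZMod M) :
    (((∑ x : ZMod M, ∑ k : ZMod M,
        ‖∑ t ∈ H, (f (x + t) : ℂ) * f (x + k + t) * stdAddChar (k * ξ t)‖ ^ 2 : ℝ)) : ℂ) =
      ∑ p ∈ H ×ˢ H, ∑ k : ZMod M, (stdAddChar (k * (ξ p.1 - ξ p.2)) : ℂ) *
        (((∑ u : ZMod M, f u * f (u + k) * f (u + (p.1 - p.2)) * f (u + k + (p.1 - p.2)) : ℝ)) : ℂ) := by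
  rw [Finset.sum_comm]
  push_cast
  rw [Finset.sum_congr rfl fun k _ => (by
    have := ofReal_sum_norm_sq_eq f H ξ k
    push_cast at this
    exact this)]
  rw [Finset.sum_product, Finset.sum_comm]
  refine Finset.sum_congr rfl fun t _ => ?_
  rw [Finset.sum_comm]

/-- Fibrewise regrouping: `∑_{p ∈ H²} Φ(π p) = ∑_v R(v) Φ(v)`, `π(t,t') = (t − t', ξ_t − ξ_{t'})`,
`R(v) = #{p ∈ H² : π p = v}`. [folklore] -/
theorem sum_pairs_eq_sum_fiber (H : Finset (ZMod M)) (ξ : ZMod M → ZMod M)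
    (Φ : ZMod M × ZMod M → ℂ) :
    ∑ p ∈ H ×ˢ H, Φ (p.1 - p.2, ξ p.1 - ξ p.2) =
      ∑ v : ZMod M × ZMod M, (#{p ∈ H ×ˢ H | (p.1 - p.2, ξ p.1 - ξ p.2) = v} : ℂ) * Φ v := by
  rw [← Finset.sum_fiberwise' (H ×ˢ H) (fun p : ZMod M × ZMod M => (p.1 - p.2, ξ p.1 - ξ p.2)) Φ]
  refine Finset.sum_congr rfl fun v _ => ?_
  rw [Finset.sum_const, nsmul_eq_mul]

/-! ### Step (f): Parseval for the phase sums `Φ(d, ·)` -/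

/-- The second-derivative sums are bounded: `|B(k,d)| ≤ M` for `|f| ≤ 1`. [folklore] -/
theorem abs_sum_four_le {f : ZMod M → ℝ} (hf : ∀ x, |f x| ≤ 1) (k d : ZMod M) :
    |∑ u : ZMod M, f u * f (u + k) * f (u + d) * f (u + k + d)| ≤ M := by
  refine (abs_sum_le_sum_abs _ _).trans ?_
  calc ∑ u : ZMod M, |f u * f (u + k) * f (u + d) * f (u + k + d)|
      ≤ ∑ _u : ZMod M, (1 : ℝ) := sum_le_sum fun u _ => by
        rw [abs_mul, abs_mul, abs_mul]
        have h1 := hf u; have h2 := hf (u + k); have h3 := hf (u + d); have h4 := hf (u + k + d)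
        calc |f u| * |f (u + k)| * |f (u + d)| * |f (u + k + d)|
            ≤ 1 * 1 * 1 * 1 := by gcongr
          _ = 1 := by norm_num
    _ = M := by rw [sum_const, card_univ, ZMod.card, nsmul_eq_mul, mul_one]

/-- `Φ(d,θ) = M · (B(·,d))^(−θ)`: the phase sum is an un-normalised Fourier coefficient. [folklore] -/
theorem phase_sum_eq_mul_dftCoeff (B : ZMod M → ℝ) (θ : ZMod M) :
    ∑ k : ZMod M, (stdAddChar (k * θ) : ℂ) * (B k : ℂ) = (M : ℂ) * dftCoeff B (-θ) := by
  have hM : (M : ℂ) ≠ 0 := by exact_mod_cast NeZero.ne M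
  unfold dftCoeff
  rw [mul_div_cancel₀ _ hM]
  refine Finset.sum_congr rfl fun k _ => ?_
  rw [mul_neg, neg_neg, mul_comm]

/-- **Parseval bound for phase sums**: if `|B(k)| ≤ M` for all `k` then
`∑_θ |∑_k e(kθ/M) B(k)|² = M ∑_k B(k)² ≤ M⁴`. [folklore] -/
theorem sum_norm_sq_phase_sum_le_of_abs_le (B : ZMod M → ℝ) (hB : ∀ k, |B k| ≤ M) :
    ∑ θ : ZMod M, ‖∑ k : ZMod M, (stdAddChar (k * θ) : ℂ) * (B k : ℂ)‖ ^ 2 ≤ (M : ℝ) ^ 4 := by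
  have hMpos : (0 : ℝ) < M := by exact_mod_cast Nat.pos_of_ne_zero (NeZero.ne M)
  have h1 : ∀ θ : ZMod M, ‖∑ k : ZMod M, (stdAddChar (k * θ) : ℂ) * (B k : ℂ)‖ ^ 2 =
      (M : ℝ) ^ 2 * ‖dftCoeff B (-θ)‖ ^ 2 := by
    intro θ
    rw [phase_sum_eq_mul_dftCoeff, norm_mul, Complex.norm_natCast, mul_pow]
  simp_rw [h1]
  have hneg : ∑ i : ZMod M, ‖dftCoeff B (-i)‖ ^ 2 = ∑ i : ZMod M, ‖dftCoeff B i‖ ^ 2 :=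
    Equiv.sum_comp (Equiv.neg (ZMod M)) (fun θ => ‖dftCoeff B θ‖ ^ 2)
  rw [← Finset.mul_sum, hneg, sum_norm_dftCoeff_sq]
  have h2 : ∑ k : ZMod M, B k ^ 2 ≤ (M : ℝ) * (M : ℝ) ^ 2 := by
    calc ∑ k : ZMod M, B k ^ 2 ≤ ∑ _k : ZMod M, (M : ℝ) ^ 2 := sum_le_sum fun k _ => by
          rw [← sq_abs]
          exact pow_le_pow_left₀ (abs_nonneg _) (hB k) 2
      _ = (M : ℝ) * (M : ℝ) ^ 2 := by rw [sum_const, card_univ, ZMod.card, nsmul_eq_mul]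
  calc (M : ℝ) ^ 2 * ((∑ k : ZMod M, B k ^ 2) / M)
      ≤ (M : ℝ) ^ 2 * ((M : ℝ) * (M : ℝ) ^ 2 / M) := by gcongr
    _ = (M : ℝ) ^ 4 := by field_simp

/-- **Parseval bound for the phase sums of the argument**: `∑_θ |Φ(d,θ)|² ≤ M⁴`,
`Φ(d,θ) = ∑_k e(kθ/M) B(k,d)`, `|B(k,d)| ≤ M`. [cite: GreenTao2008U3Inverse, §5, proof of Prop. 5.4] -/
theorem sum_norm_sq_phase_sum_le {f : ZMod M → ℝ} (hf : ∀ x, |f x| ≤ 1) (d : ZMod M) :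
    ∑ θ : ZMod M, ‖∑ k : ZMod M, (stdAddChar (k * θ) : ℂ) *
        (((∑ u : ZMod M, f u * f (u + k) * f (u + d) * f (u + k + d) : ℝ)) : ℂ)‖ ^ 2 ≤ (M : ℝ) ^ 4 :=
  sum_norm_sq_phase_sum_le_of_abs_le
    (fun k => ∑ u : ZMod M, f u * f (u + k) * f (u + d) * f (u + k + d))
    fun k => abs_sum_four_le hf k d

/-! ### Step (g): the second Cauchy–Schwarz — the core inequality -/

/-- **Gowers' additive-quadruple inequality (core).** If `|f| ≤ 1` on `ℤ/Mℤ` and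
`|(Δ_t f)^(ξ_t)|² ≥ γ ≥ 0` for all `t ∈ H`, then, with `R(v) = #{(t,t') ∈ H² : (t − t', ξ_t − ξ_{t'}) = v}`,
`γ⁴ (#H)⁴ ≤ M · ∑_v R(v)²`. [cite: GreenTao2008U3Inverse, Prop. 5.4 (second half)] -/
theorem gowers_fiber_energy_ge {f : ZMod M → ℝ} (hf : ∀ x, |f x| ≤ 1) (H : Finset (ZMod M))
    (ξ : ZMod M → ZMod M) {γ : ℝ} (hγ : 0 ≤ γ)
    (hH : ∀ t ∈ H, γ ≤ ‖dftCoeff (fun y => f y * f (y + t)) (ξ t)‖ ^ 2) :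
    γ ^ 4 * (#H : ℝ) ^ 4 ≤
      M * ∑ v : ZMod M × ZMod M, (#{p ∈ H ×ˢ H | (p.1 - p.2, ξ p.1 - ξ p.2) = v} : ℝ) ^ 2 := by
  have hMpos : (0 : ℝ) < M := by exact_mod_cast Nat.pos_of_ne_zero (NeZero.ne M)
  -- the objects
  set S : ZMod M → ZMod M → ℂ := fun x k =>
    ∑ t ∈ H, (f (x + t) : ℂ) * f (x + k + t) * stdAddChar (k * ξ t) with hS
  set Φ : ZMod M × ZMod M → ℂ := fun v => ∑ k : ZMod M, (stdAddChar (k * v.2) : ℂ) *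
    (((∑ u : ZMod M, f u * f (u + k) * f (u + v.1) * f (u + k + v.1) : ℝ)) : ℂ) with hΦ
  set R : ZMod M × ZMod M → ℕ := fun v => #{p ∈ H ×ˢ H | (p.1 - p.2, ξ p.1 - ξ p.2) = v} with hR
  set T : ℝ := ∑ x : ZMod M, ∑ k : ZMod M, ‖S x k‖ with hT
  set U : ℝ := ∑ x : ZMod M, ∑ k : ZMod M, ‖S x k‖ ^ 2 with hU
  set V : ℝ := ∑ v : ZMod M × ZMod M, (R v : ℝ) * ‖Φ v‖ with hV
  -- (c) first Cauchy–Schwarz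
  have h1 : γ * #H ≤ T / ((M : ℝ) * M) := mul_card_le_sum_norm hf H ξ hH
  have h2 : T ^ 2 ≤ ((M : ℝ) * M) * U := sq_sum_sum_norm_le S
  -- (d)+(e): `U = ∑_v R(v) Φ(v)` as complex numbers, hence `U ≤ V`
  have h3 : ((U : ℝ) : ℂ) = ∑ v : ZMod M × ZMod M, (R v : ℂ) * Φ v := by
    rw [hU, ofReal_sum_sum_norm_sq_eq_sum_pairs f H ξ]
    exact sum_pairs_eq_sum_fiber H ξ Φ
  have hU0 : 0 ≤ U := sum_nonneg fun x _ => sum_nonneg fun k _ => by positivity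
  have h4 : U ≤ V := by
    have : U = ‖((U : ℝ) : ℂ)‖ := by rw [Complex.norm_real, Real.norm_of_nonneg hU0]
    rw [this, h3]
    refine (norm_sum_le _ _).trans (le_of_eq (Finset.sum_congr rfl fun v _ => ?_))
    rw [norm_mul, Complex.norm_natCast]
  -- (f)+(g): second Cauchy–Schwarz and Parseval
  have h5 : V ^ 2 ≤ (∑ v : ZMod M × ZMod M, (R v : ℝ) ^ 2) *
      ∑ v : ZMod M × ZMod M, ‖Φ v‖ ^ 2 :=
    Finset.sum_mul_sq_le_sq_mul_sq univ (fun v => (R v : ℝ)) (fun v => ‖Φ v‖)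
  have h6 : ∑ v : ZMod M × ZMod M, ‖Φ v‖ ^ 2 ≤ (M : ℝ) * (M : ℝ) ^ 4 := by
    rw [Fintype.sum_prod_type]
    calc ∑ d : ZMod M, ∑ θ : ZMod M, ‖Φ (d, θ)‖ ^ 2 ≤ ∑ _d : ZMod M, (M : ℝ) ^ 4 :=
          sum_le_sum fun d _ => sum_norm_sq_phase_sum_le hf d
      _ = (M : ℝ) * (M : ℝ) ^ 4 := by rw [sum_const, card_univ, ZMod.card, nsmul_eq_mul]
  -- assembling
  have hγH : 0 ≤ γ * #H := mul_nonneg hγ (Nat.cast_nonneg _)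
  have h7 : (γ * #H) ^ 2 * ((M : ℝ) * M) ≤ U := by
    have hMM : (0 : ℝ) < (M : ℝ) * M := by positivity
    have h1' : (γ * #H) * ((M : ℝ) * M) ≤ T := (le_div_iff₀ hMM).mp h1
    have h8 : ((γ * #H) * ((M : ℝ) * M)) ^ 2 ≤ T ^ 2 :=
      pow_le_pow_left₀ (mul_nonneg hγH hMM.le) h1' 2
    have h8' : (γ * #H) ^ 2 * ((M : ℝ) * M) * ((M : ℝ) * M) ≤ U * ((M : ℝ) * M) := by
      calc (γ * #H) ^ 2 * ((M : ℝ) * M) * ((M : ℝ) * M)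
          = ((γ * #H) * ((M : ℝ) * M)) ^ 2 := by ring
        _ ≤ T ^ 2 := h8
        _ ≤ ((M : ℝ) * M) * U := h2
        _ = U * ((M : ℝ) * M) := by ring
    exact le_of_mul_le_mul_right h8' hMM
  have h9 : ((γ * #H) ^ 2 * ((M : ℝ) * M)) ^ 2 ≤
      (∑ v : ZMod M × ZMod M, (R v : ℝ) ^ 2) * ((M : ℝ) * (M : ℝ) ^ 4) := by
    have hV0 : 0 ≤ (γ * #H) ^ 2 * ((M : ℝ) * M) := by positivity
    calc ((γ * #H) ^ 2 * ((M : ℝ) * M)) ^ 2 ≤ V ^ 2 := pow_le_pow_left₀ hV0 (h7.trans h4) 2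
      _ ≤ _ := h5.trans (mul_le_mul_of_nonneg_left h6 (sum_nonneg fun v _ => sq_nonneg _))
  -- divide by `M⁴`
  have hM4 : (0 : ℝ) < (M : ℝ) ^ 4 := by positivity
  have key : (γ ^ 4 * (#H : ℝ) ^ 4) * (M : ℝ) ^ 4 ≤
      (M * ∑ v : ZMod M × ZMod M, (R v : ℝ) ^ 2) * (M : ℝ) ^ 4 := by
    calc (γ ^ 4 * (#H : ℝ) ^ 4) * (M : ℝ) ^ 4 = ((γ * #H) ^ 2 * ((M : ℝ) * M)) ^ 2 := by ring
      _ ≤ (∑ v : ZMod M × ZMod M, (R v : ℝ) ^ 2) * ((M : ℝ) * (M : ℝ) ^ 4) := h9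
      _ = (M * ∑ v : ZMod M × ZMod M, (R v : ℝ) ^ 2) * (M : ℝ) ^ 4 := by ring
  exact le_of_mul_le_mul_right key hM4

/-! ### Step (h): fibres and quadruples -/

/-- Counting pairs in a common fibre: `∑_v #{p ∈ s : π p = v}² = #{(p,q) ∈ s² : π p = π q}`.
[folklore] -/
theorem sum_sq_card_fiber_eq_card_filter {α κ : Type*} [Fintype κ] [DecidableEq κ]
    (s : Finset α) (π : α → κ) :
    ∑ v : κ, #{p ∈ s | π p = v} ^ 2 = #{q ∈ s ×ˢ s | π q.1 = π q.2} := by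
  have h1 : #{q ∈ s ×ˢ s | π q.1 = π q.2} = ∑ p ∈ s, #{q ∈ s | π q = π p} := by
    rw [card_filter, Finset.sum_product]
    refine Finset.sum_congr rfl fun p _ => ?_
    rw [card_filter]
    refine Finset.sum_congr rfl fun q _ => ?_
    simp only [eq_comm]
  rw [h1, ← Finset.sum_fiberwise s π (fun p => #{q ∈ s | π q = π p})]
  refine Finset.sum_congr rfl fun v _ => ?_
  rw [sq, ← smul_eq_mul, ← Finset.sum_const]
  refine Finset.sum_congr rfl fun p hp => ?_
  rw [(Finset.mem_filter.mp hp).2]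

/-- The fibre energy is the number of (difference-form) additive quadruples of the graph of `ξ` on
`H`: `∑_v R(v)² = #{(t₁,t₂,t₃,t₄) ∈ H⁴ : t₁ − t₂ = t₃ − t₄, ξ_{t₁} − ξ_{t₂} = ξ_{t₃} − ξ_{t₄}}`.
[folklore] -/
theorem sum_sq_card_fiber_eq_card_quadruples (H : Finset (ZMod M)) (ξ : ZMod M → ZMod M) :
    ((∑ v : ZMod M × ZMod M, (#{p ∈ H ×ˢ H | (p.1 - p.2, ξ p.1 - ξ p.2) = v} : ℝ) ^ 2 : ℝ)) =
      #{q ∈ (H ×ˢ H) ×ˢ (H ×ˢ H) |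
        q.1.1 - q.1.2 = q.2.1 - q.2.2 ∧ ξ q.1.1 - ξ q.1.2 = ξ q.2.1 - ξ q.2.2} := by
  have h := sum_sq_card_fiber_eq_card_filter (H ×ˢ H)
    (fun p : ZMod M × ZMod M => (p.1 - p.2, ξ p.1 - ξ p.2))
  have h' : #{q ∈ (H ×ˢ H) ×ˢ (H ×ˢ H) |
      (fun p : ZMod M × ZMod M => (p.1 - p.2, ξ p.1 - ξ p.2)) q.1 =
        (fun p : ZMod M × ZMod M => (p.1 - p.2, ξ p.1 - ξ p.2)) q.2} =
      #{q ∈ (H ×ˢ H) ×ˢ (H ×ˢ H) |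
        q.1.1 - q.1.2 = q.2.1 - q.2.2 ∧ ξ q.1.1 - ξ q.1.2 = ξ q.2.1 - ξ q.2.2} := by
    congr 1
    ext q
    simp only [Finset.mem_filter, Finset.mem_product, Prod.mk.injEq]
  rw [h'] at h
  exact_mod_cast h

/-- **Gowers' additive-quadruple inequality (counting form).** Under the hypotheses of
`gowers_fiber_energy_ge`: `γ⁴ (#H)⁴ / M ≤ #{(t₁,t₂,t₃,t₄) ∈ H⁴ : t₁ − t₂ = t₃ − t₄,
ξ_{t₁} − ξ_{t₂} = ξ_{t₃} − ξ_{t₄}}`. [cite: GreenTao2008U3Inverse, Prop. 5.4 (second half)] -/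
theorem card_quadruples_ge {f : ZMod M → ℝ} (hf : ∀ x, |f x| ≤ 1) (H : Finset (ZMod M))
    (ξ : ZMod M → ZMod M) {γ : ℝ} (hγ : 0 ≤ γ)
    (hH : ∀ t ∈ H, γ ≤ ‖dftCoeff (fun y => f y * f (y + t)) (ξ t)‖ ^ 2) :
    γ ^ 4 * (#H : ℝ) ^ 4 / M ≤
      #{q ∈ (H ×ˢ H) ×ˢ (H ×ˢ H) |
        q.1.1 - q.1.2 = q.2.1 - q.2.2 ∧ ξ q.1.1 - ξ q.1.2 = ξ q.2.1 - ξ q.2.2} := by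
  have hMpos : (0 : ℝ) < M := by exact_mod_cast Nat.pos_of_ne_zero (NeZero.ne M)
  rw [div_le_iff₀' hMpos, ← sum_sq_card_fiber_eq_card_quadruples]
  exact gowers_fiber_energy_ge hf H ξ hγ hH

/-- **GT08a Prop. 5.4 (Gowers): large `U³` norm ⇒ a frequency function with many additive
quadruples.** If `|f| ≤ 1` on `ℤ/Mℤ` and `‖f‖_{U³(ℤ/Mℤ)}^8 ≥ ε > 0`, there are `H ⊆ ℤ/Mℤ` with
`#H ≥ εM/2` and `ξ : ℤ/Mℤ → ℤ/Mℤ` with `|(Δ_t f)^(ξ_t)|² ≥ ε/2` on `H`, whose graph has at least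
`ε⁸ M³ / 256` additive quadruples `t₁ − t₂ = t₃ − t₄`, `ξ_{t₁} − ξ_{t₂} = ξ_{t₃} − ξ_{t₄}` in `H⁴`.
[cite: GreenTao2008U3Inverse, Prop. 5.4] -/
theorem exists_shifts_freq_quadruples_of_gowersPower_three {f : ZMod M → ℝ} (hf : ∀ x, |f x| ≤ 1)
    {ε : ℝ} (hε0 : 0 < ε) (hε : ε ≤ gowersPower 3 f) :
    ∃ (H : Finset (ZMod M)) (ξ : ZMod M → ZMod M), ε / 2 * M ≤ #H ∧
      (∀ t ∈ H, ε / 2 ≤ ‖dftCoeff (fun y => f y * f (y + t)) (ξ t)‖ ^ 2) ∧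
      ε ^ 8 / 256 * (M : ℝ) ^ 3 ≤
        #{q ∈ (H ×ˢ H) ×ˢ (H ×ˢ H) |
          q.1.1 - q.1.2 = q.2.1 - q.2.2 ∧ ξ q.1.1 - ξ q.1.2 = ξ q.2.1 - ξ q.2.2} := by
  have hMpos : (0 : ℝ) < M := by exact_mod_cast Nat.pos_of_ne_zero (NeZero.ne M)
  obtain ⟨H, ξ, hcard, hH⟩ := exists_shifts_freq_of_gowersPower_three hf hε
  refine ⟨H, ξ, hcard, hH, ?_⟩
  have hq := card_quadruples_ge hf H ξ (by positivity : (0 : ℝ) ≤ ε / 2) hH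
  refine le_trans ?_ hq
  rw [le_div_iff₀ hMpos]
  have hε2 : 0 ≤ ε / 2 * M := by positivity
  have h4 : (ε / 2 * M) ^ 4 ≤ (#H : ℝ) ^ 4 := pow_le_pow_left₀ hε2 hcard 4
  calc ε ^ 8 / 256 * (M : ℝ) ^ 3 * M = (ε / 2) ^ 4 * (ε / 2 * M) ^ 4 := by ring
    _ ≤ (ε / 2) ^ 4 * (#H : ℝ) ^ 4 := by gcongr

end Summit.Parity.GeneralizedHardyLittlewood.GreenTaoLevelTwoGITwoCyclicInverse
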